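import Summits.NavierStokesRegularity.NavierStokesRegularity.Theorems.ExtremiserTransienceNearExtremalTransienceExtremiserLiouvilleConstantSpeedRellich
import Summits.NavierStokesRegularity.NavierStokesRegularity.Theorems.ExtremiserTransienceNearExtremalTransienceExtremiserLiouvilleConstantSpeedWeakLimitExtraction
import Summits.NavierStokesRegularity.NavierStokesRegularity.Theorems.ExtremiserTransienceNearExtremalTransienceExtremiserLiouvilleConstantSpeedJetGrowth
import HarnessLib

/-!
# Crux `ExtremiserTransience.NearExtremalTransience` (stmt-NavierStokesRegularity-21883), line `extremiser_liouville`,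
# stub K1b — THE JET ALTERNATIVE DIES UNDER AN `H¹` RATE ON ONE WINDOW (record §8 case (β), fully assembled)

`--supports stmt-NavierStokesRegularity-21883` (helper).  Author: prover seat `ns-el-k1b` (g6).  Everything from g6's two cycles
assembled into ONE implication with no limit object among the hypotheses: let `(v, μ)` be a K1b residue (general frame: smooth,
solenoidal, `‖v‖ ≡ M = ‖c‖`, `Dv, D²v ∈ L²`, `M√Z√W > 0`, multiplier identity with a finite measure, `v − c ∈ L⁶`) with linear
excess-energy growth `∫⁻_{B_ρ}‖v − c‖ₑ² ≤ C ρ` (`ρ ≥ 1`; automatic for the axial jet, `…ConstantSpeedJetGrowth`).  Let `Rₙ ≥ 1`,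
`Rₙ → ∞`, and suppose that on ONE ball `B(x₁, L₁+1)` the blow-downs `Vₙ = Rₙ(v(Rₙ·) − c)` have `∫⁻‖DVₙ‖ₑ² ≤ A < ∞` (in original
variables: `Rₙ ∫_{B(Rₙx₁, Rₙ(L₁+1))}‖Dv‖² ≤ A`, `lintegral_ball_fderiv_blowDown_sq`) while `∫⁻_{B(x₁,L₁)}‖Vₙ‖ₑ² ≥ e₀ > 0`.  Then `False`:
extract a weak `L²_loc` limit `U` along a subsequence (`exists_subseq_weakLimit_of_growth`); `U = 0` by the vorticity law + div–curl
growth Liouville (`blowDown_weakLimit_ae_eq_zero`); the subsequence is weakly null and `H¹`-bounded on the window, so its `L²` mass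
there tends to `0` (Rellich criterion) — contradicting `e₀ > 0` (`blowDown_window_false_of_H1bound`).

* `jet_false_of_H1rate_on_window` : the statement above;
* `axialJet_false_of_H1rate_on_window` : the same with the growth hypothesis discharged from the axial dossier's jet data
  (`c₀ = c₁ = 0 ≠ c₂`, slab energies finite, `H′`-window energies `≡ E₀ > 0`; `…ConstantSpeedJetGrowth`);
* `axialJet_false_of_annular_H1rate` : everything in ORIGINAL variables — the annular rate
  `Rₙ∫⁻_{Rₙ/2<|y|<4Rₙ}‖Dv‖ₑ² ≤ A` (N11′) and the window energy `e₀Rₙ ≤ ∫⁻_{B(Rₙx₁,RₙL₁)}‖v − c‖ₑ²` (sub-conicality) ⇒ `False`.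

So K1b's jet alternative is reduced to the analytic estimate (N11′): an `O(1/R)` bound for `∫_{B(Rx₁,RL)}‖Dv‖²` on windows along
the axis (plus the window energy lower bound, which is the definition of a sub-conical jet).  WHAT THIS IS NOT: K1b is NOT proved;
nothing here proves NS regularity. [folklore]
-/

noncomputable section

open Set Filter Topology MeasureTheory Metric Function
open scoped ENNReal NNReal Topology InnerProductSpace RealInnerProductSpace ContDiff
open Literature.Analysis.FluidPDE Literature.Analysis

namespace Summit.NavierStokesRegularity.NavierStokesRegularity.Theorems

-- the problem directory repeats the summit name (`NavierStokesRegularity/NavierStokesRegularity`)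
set_option linter.dupNamespace false

namespace ExtremiserLiouville

open DepletionLadder.KStar DepletionLadder.KStar.HalfSpace

variable {v : E3 → E3} {c : E3}

/-- **The jet dies under an `H¹` rate on one window.**  See the module docstring.  (K1b itself is NOT proved here: the `H¹` rate
is the open analytic input (N11′).) [folklore] -/
theorem jet_false_of_H1rate_on_window (hv : ContDiff ℝ ∞ v) (hdiv : VectorCalculus.IsDivFree v) {M : ℝ}
    (hM : ∀ x, ‖v x‖ = M) (h1 : ∫⁻ x, ‖iteratedFDeriv ℝ 1 v x‖ₑ ^ 2 < ⊤) (h2 : ∫⁻ x, ‖iteratedFDeriv ℝ 2 v x‖ₑ ^ 2 < ⊤)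
    (hpos : 0 < M * Real.sqrt (Zen v) * Real.sqrt (Wpa v))
    (μ : Measure E3) [IsFiniteMeasure μ]
    (hμ : ∀ ψ : E3 → E3, ContDiff ℝ ∞ ψ → HasCompactSupport ψ → VectorCalculus.IsDivFree ψ →
      Jst v * J1 v ψ - kStar ^ 2 * M ^ 2 * (Wpa v * A1 v ψ + Zen v * C1 v ψ) = ∫ x, ⟪v x, ψ x⟫_ℝ ∂μ)
    (hc : c ≠ 0) (hcM : ‖c‖ = M) (hL6 : MemLp (fun x => v x - c) 6 volume)
    {Cg : ℝ} (hCg : 0 < Cg) (hgrowth : ∀ ρ : ℝ, 1 ≤ ρ → ∫⁻ x in ball (0 : E3) ρ, ‖v x - c‖ₑ ^ 2 ≤ ENNReal.ofReal (Cg * ρ))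
    {Rn : ℕ → ℝ} (hRn1 : ∀ n, 1 ≤ Rn n) (hRn : Tendsto Rn atTop atTop)
    (x₁ : E3) (L₁ : ℝ) {A : ℝ≥0∞} (hAtop : A ≠ ⊤)
    (hDV2 : ∀ n, ∫⁻ x in ball x₁ (L₁ + 1), ‖fderiv ℝ (fun x => Rn n • (v (Rn n • x) - c)) x‖ₑ ^ 2 ≤ A)
    {e₀ : ℝ} (he₀ : 0 < e₀) (hlow : ∀ n, ENNReal.ofReal e₀ ≤ ∫⁻ x in ball x₁ L₁, ‖Rn n • (v (Rn n • x) - c)‖ₑ ^ 2) :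
    False := by
  set F : ℕ → E3 → E3 := fun n x => Rn n • (v (Rn n • x) - c) with hF
  have hRn0 : ∀ n, 0 < Rn n := fun n => one_pos.trans_le (hRn1 n)
  have hv1 : ContDiff ℝ 1 v := hv.of_le (by exact_mod_cast le_top)
  have hFc : ∀ n, Continuous (F n) := fun n => (contDiff_blowDown hv1 c (Rn n)).continuous
  -- growth of the blow-downs on balls centred at the origin
  have hbdF : ∀ n, ∀ L : ℝ, 1 ≤ L → ∫⁻ x in ball (0 : E3) L, ‖F n x‖ₑ ^ 2 ≤ ENNReal.ofReal (Cg * L) := by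
    intro n L hL
    show ∫⁻ x in ball (0 : E3) L, ‖Rn n • (v (Rn n • x) - c)‖ₑ ^ 2 ≤ ENNReal.ofReal (Cg * L)
    rw [lintegral_ball_blowDown_sq v c (hRn0 n) L]
    have hg := hgrowth (Rn n * L) (by nlinarith [hRn1 n])
    calc ENNReal.ofReal (Rn n)⁻¹ * ∫⁻ x in ball (0 : E3) (Rn n * L), ‖v x - c‖ₑ ^ 2
        ≤ ENNReal.ofReal (Rn n)⁻¹ * ENNReal.ofReal (Cg * (Rn n * L)) := mul_le_mul' le_rfl hg
      _ = ENNReal.ofReal (Cg * L) := by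
          rw [← ENNReal.ofReal_mul (inv_nonneg.2 (hRn0 n).le)]
          have e : (Rn n)⁻¹ * (Cg * (Rn n * L)) = Cg * L := by
            rw [← mul_assoc, ← mul_assoc, mul_comm (Rn n)⁻¹, mul_assoc Cg, inv_mul_cancel₀ (hRn0 n).ne', mul_one]
          rw [e]
  -- extract a weak `L²_loc` limit along a subsequence
  obtain ⟨U, ns, hns, hU, hUl, hUg, hpair⟩ := exists_subseq_weakLimit_of_growth hFc hCg hbdF
  -- `L²` bound on the window ball (it sits inside a ball centred at the origin)
  set L' : ℝ := max 1 (‖x₁‖ + L₁ + 1) with hL'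
  have hL'1 : 1 ≤ L' := le_max_left _ _
  have hsub : ball x₁ (L₁ + 1) ⊆ ball (0 : E3) L' := by
    intro y hy
    rw [mem_ball] at hy
    rw [mem_ball_zero_iff]
    calc ‖y‖ = ‖(y - x₁) + x₁‖ := by rw [sub_add_cancel]
      _ ≤ ‖y - x₁‖ + ‖x₁‖ := norm_add_le _ _
      _ < L₁ + 1 + ‖x₁‖ := by rw [← dist_eq_norm]; linarith
      _ ≤ L' := by rw [hL']; linarith [le_max_right 1 (‖x₁‖ + L₁ + 1)]
  set A' : ℝ≥0∞ := max A (ENNReal.ofReal (Cg * L')) with hA'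
  have hA'top : A' ≠ ⊤ := (max_lt hAtop.lt_top ENNReal.ofReal_lt_top).ne
  have hV2 : ∀ j, ∫⁻ x in ball x₁ (L₁ + 1), ‖F (ns j) x‖ₑ ^ 2 ≤ A' := fun j =>
    ((lintegral_mono_set hsub).trans (hbdF (ns j) L' hL'1)).trans (le_max_right _ _)
  have hDV2' : ∀ j, ∫⁻ x in ball x₁ (L₁ + 1), ‖fderiv ℝ (F (ns j)) x‖ₑ ^ 2 ≤ A' := fun j =>
    (hDV2 (ns j)).trans (le_max_left _ _)
  exact blowDown_window_false_of_H1bound hv hdiv hM h1 h2 hpos μ hμ hc hcM hL6 (Rn := fun j => Rn (ns j))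
    (fun j => hRn1 (ns j)) (hRn.comp hns.tendsto_atTop) hU hUl hpair (C := 16 * Cg) (θ := 2) (by positivity)
    (by norm_num) (by norm_num) hUg x₁ L₁ hA'top hV2 hDV2' he₀ (fun j => hlow (ns j))

/-- **The axial jet dies under an `H¹` rate on one window** — `jet_false_of_H1rate_on_window` with the linear growth
discharged from the axial dossier's (J) data via `lintegral_ball_excess_sq_le_of_jet`.  (K1b itself is NOT proved here.) [folklore] -/
theorem axialJet_false_of_H1rate_on_window (hv : ContDiff ℝ ∞ v) (hdiv : VectorCalculus.IsDivFree v) {M : ℝ}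
    (hM : ∀ x, ‖v x‖ = M) (h1 : ∫⁻ x, ‖iteratedFDeriv ℝ 1 v x‖ₑ ^ 2 < ⊤) (h2 : ∫⁻ x, ‖iteratedFDeriv ℝ 2 v x‖ₑ ^ 2 < ⊤)
    (hpos : 0 < M * Real.sqrt (Zen v) * Real.sqrt (Wpa v))
    (μ : Measure E3) [IsFiniteMeasure μ]
    (hμ : ∀ ψ : E3 → E3, ContDiff ℝ ∞ ψ → HasCompactSupport ψ → VectorCalculus.IsDivFree ψ →
      Jst v * J1 v ψ - kStar ^ 2 * M ^ 2 * (Wpa v * A1 v ψ + Zen v * C1 v ψ) = ∫ x, ⟪v x, ψ x⟫_ℝ ∂μ)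
    (hc0 : c 0 = 0) (hc1 : c 1 = 0) (hc2 : c 2 ≠ 0) (hcM : ‖c‖ = M) (hL6 : MemLp (fun x => v x - c) 6 volume)
    (hslab : ∀ T : ℝ, 0 < T → Integrable (fun x => {x : E3 | |x 2| ≤ T}.indicator (fun x => ‖v x - c‖ ^ 2) x) volume)
    {E₀ : ℝ} (hE0 : 0 < E₀) (hE : ∀ s : ℝ, (∫ x, deriv Real.smoothTransition (x 2 - s) * ‖v x - c‖ ^ 2) = E₀)
    {Rn : ℕ → ℝ} (hRn1 : ∀ n, 1 ≤ Rn n) (hRn : Tendsto Rn atTop atTop)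
    (x₁ : E3) (L₁ : ℝ) {A : ℝ≥0∞} (hAtop : A ≠ ⊤)
    (hDV2 : ∀ n, ∫⁻ x in ball x₁ (L₁ + 1), ‖fderiv ℝ (fun x => Rn n • (v (Rn n • x) - c)) x‖ₑ ^ 2 ≤ A)
    {e₀ : ℝ} (he₀ : 0 < e₀) (hlow : ∀ n, ENNReal.ofReal e₀ ≤ ∫⁻ x in ball x₁ L₁, ‖Rn n • (v (Rn n • x) - c)‖ₑ ^ 2) :
    False := by
  have hc : c ≠ 0 := fun h => hc2 (by simp [h])
  have hv1 : ContDiff ℝ 1 v := hv.of_le (by exact_mod_cast le_top)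
  have hgrowth : ∀ ρ : ℝ, 1 ≤ ρ → ∫⁻ x in ball (0 : E3) ρ, ‖v x - c‖ₑ ^ 2 ≤ ENNReal.ofReal (5 * E₀ * ρ) :=
    fun ρ hρ => lintegral_ball_excess_sq_le_of_jet hv1 hdiv hM hcM hc0 hc1 hc2 hslab hE0.le hE hρ
  exact jet_false_of_H1rate_on_window hv hdiv hM h1 h2 hpos μ hμ hc hcM hL6 (Cg := 5 * E₀) (by positivity) hgrowth
    hRn1 hRn x₁ L₁ hAtop hDV2 he₀ hlow

/-- **`L²`-mass of a blow-down on a ball with arbitrary centre, in original variables**: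
`∫⁻_{B(x₁,L)} ‖R(v(Rx) − c)‖ₑ² = R⁻¹ ∫⁻_{B(Rx₁,RL)} ‖v − c‖ₑ²` (`R > 0`). [folklore] -/
theorem lintegral_ball_blowDown_sq' (v : E3 → E3) (c : E3) {R : ℝ} (hR : 0 < R) (x₁ : E3) (L : ℝ) :
    ∫⁻ x in ball x₁ L, ‖R • (v (R • x) - c)‖ₑ ^ 2 =
      ENNReal.ofReal R⁻¹ * ∫⁻ y in ball (R • x₁) (R * L), ‖v y - c‖ₑ ^ 2 := by
  have h1 : ∀ x, ‖R • (v (R • x) - c)‖ₑ ^ 2 = ENNReal.ofReal (R ^ 2) * ‖v (R • x) - c‖ₑ ^ 2 := by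
    intro x
    rw [enorm_smul, mul_pow, Real.enorm_eq_ofReal hR.le, ENNReal.ofReal_pow hR.le]
  simp_rw [h1]
  rw [lintegral_const_mul' _ _ ENNReal.ofReal_ne_top, ← lintegral_indicator measurableSet_ball,
    ← lintegral_indicator measurableSet_ball]
  have h2 : (ball x₁ L).indicator (fun x => ‖v (R • x) - c‖ₑ ^ 2) =
      fun x => (ball (R • x₁) (R * L)).indicator (fun y => ‖v y - c‖ₑ ^ 2) (R • x) := by
    funext x
    have hiff : x ∈ ball x₁ L ↔ R • x ∈ ball (R • x₁) (R * L) := by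
      rw [mem_ball, mem_ball, dist_eq_norm, dist_eq_norm, ← smul_sub, norm_smul, Real.norm_eq_abs, abs_of_pos hR]
      exact ⟨fun h => mul_lt_mul_of_pos_left h hR, fun h => lt_of_mul_lt_mul_left h hR.le⟩
    by_cases hx : x ∈ ball x₁ L
    · rw [indicator_of_mem hx, indicator_of_mem (hiff.1 hx)]
    · rw [indicator_of_notMem hx, indicator_of_notMem (fun h => hx (hiff.2 h))]
  rw [h2, lintegral_comp_smul_E3 _ hR, ← mul_assoc, ← ENNReal.ofReal_mul (sq_nonneg _)]
  congr 2
  field_simp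

/-- **The axial jet dies under an ANNULAR `H¹` rate, all in original variables.**  Residue with the axial dossier's jet data;
`Rₙ ≥ 1`, `Rₙ → ∞`; a window centre `x₁` and radius `L₁` with `B(x₁, L₁+1) ⊆ {1/2 < |y| < 4}` (e.g. `x₁ = 2ĉ`, `L₁ = 1/2`);
HYPOTHESES IN ORIGINAL VARIABLES: the annular rate `Rₙ · ∫⁻_{Rₙ/2 < |y| < 4Rₙ} ‖Dv‖ₑ² ≤ A < ∞` (N11′) and the window energy
`e₀ Rₙ ≤ ∫⁻_{B(Rₙx₁, RₙL₁)} ‖v − c‖ₑ²` (sub-conicality).  Then `False`.  (K1b itself is NOT proved here.) [folklore] -/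
theorem axialJet_false_of_annular_H1rate (hv : ContDiff ℝ ∞ v) (hdiv : VectorCalculus.IsDivFree v) {M : ℝ}
    (hM : ∀ x, ‖v x‖ = M) (h1 : ∫⁻ x, ‖iteratedFDeriv ℝ 1 v x‖ₑ ^ 2 < ⊤) (h2 : ∫⁻ x, ‖iteratedFDeriv ℝ 2 v x‖ₑ ^ 2 < ⊤)
    (hpos : 0 < M * Real.sqrt (Zen v) * Real.sqrt (Wpa v))
    (μ : Measure E3) [IsFiniteMeasure μ]
    (hμ : ∀ ψ : E3 → E3, ContDiff ℝ ∞ ψ → HasCompactSupport ψ → VectorCalculus.IsDivFree ψ →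
      Jst v * J1 v ψ - kStar ^ 2 * M ^ 2 * (Wpa v * A1 v ψ + Zen v * C1 v ψ) = ∫ x, ⟪v x, ψ x⟫_ℝ ∂μ)
    (hc0 : c 0 = 0) (hc1 : c 1 = 0) (hc2 : c 2 ≠ 0) (hcM : ‖c‖ = M) (hL6 : MemLp (fun x => v x - c) 6 volume)
    (hslab : ∀ T : ℝ, 0 < T → Integrable (fun x => {x : E3 | |x 2| ≤ T}.indicator (fun x => ‖v x - c‖ ^ 2) x) volume)
    {E₀ : ℝ} (hE0 : 0 < E₀) (hE : ∀ s : ℝ, (∫ x, deriv Real.smoothTransition (x 2 - s) * ‖v x - c‖ ^ 2) = E₀)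
    {Rn : ℕ → ℝ} (hRn1 : ∀ n, 1 ≤ Rn n) (hRn : Tendsto Rn atTop atTop)
    {x₁ : E3} {L₁ : ℝ} (hwin : ball x₁ (L₁ + 1) ⊆ ball (0 : E3) 4 \ closedBall (0 : E3) 2⁻¹)
    {A : ℝ≥0∞} (hAtop : A ≠ ⊤)
    (hann : ∀ n, ENNReal.ofReal (Rn n) * ∫⁻ y in ball (0 : E3) (4 * Rn n) \ closedBall (0 : E3) (2⁻¹ * Rn n),
      ‖fderiv ℝ v y‖ₑ ^ 2 ≤ A)
    {e₀ : ℝ} (he₀ : 0 < e₀)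
    (hlow : ∀ n, ENNReal.ofReal (e₀ * Rn n) ≤ ∫⁻ y in ball (Rn n • x₁) (Rn n * L₁), ‖v y - c‖ₑ ^ 2) :
    False := by
  have hRn0 : ∀ n, 0 < Rn n := fun n => one_pos.trans_le (hRn1 n)
  have hvd : Differentiable ℝ v := (hv.of_le (by exact_mod_cast le_top) : ContDiff ℝ 1 v).differentiable one_ne_zero
  -- the `H¹` rate on the window, in blow-down variables
  have hDV2 : ∀ n, ∫⁻ x in ball x₁ (L₁ + 1), ‖fderiv ℝ (fun x => Rn n • (v (Rn n • x) - c)) x‖ₑ ^ 2 ≤ A := by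
    intro n
    rw [lintegral_ball_fderiv_blowDown_sq hvd c (hRn0 n) x₁ (L₁ + 1)]
    have hsub : ball (Rn n • x₁) (Rn n * (L₁ + 1)) ⊆ ball (0 : E3) (4 * Rn n) \ closedBall (0 : E3) (2⁻¹ * Rn n) := by
      intro y hy
      have hy' : (Rn n)⁻¹ • y ∈ ball x₁ (L₁ + 1) := by
        rw [mem_ball, dist_eq_norm] at hy ⊢
        have : (Rn n)⁻¹ • y - x₁ = (Rn n)⁻¹ • (y - Rn n • x₁) := by
          rw [smul_sub, smul_smul, inv_mul_cancel₀ (hRn0 n).ne', one_smul]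
        rw [this, norm_smul, Real.norm_eq_abs, abs_of_pos (inv_pos.2 (hRn0 n))]
        rw [inv_mul_lt_iff₀ (hRn0 n)]; exact hy
      have h := hwin hy'
      rw [Set.mem_sdiff, mem_ball_zero_iff, mem_closedBall_zero_iff, not_le, norm_smul, Real.norm_eq_abs,
        abs_of_pos (inv_pos.2 (hRn0 n))] at h
      rw [Set.mem_sdiff, mem_ball_zero_iff, mem_closedBall_zero_iff, not_le]
      constructor
      · have := h.1; rw [inv_mul_lt_iff₀ (hRn0 n)] at this; linarith
      · have := h.2; rw [lt_inv_mul_iff₀ (hRn0 n)] at this; linarith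
    exact (mul_le_mul' le_rfl (lintegral_mono_set hsub)).trans (hann n)
  -- the window energy, in blow-down variables
  have hlow' : ∀ n, ENNReal.ofReal e₀ ≤ ∫⁻ x in ball x₁ L₁, ‖Rn n • (v (Rn n • x) - c)‖ₑ ^ 2 := by
    intro n
    rw [lintegral_ball_blowDown_sq' v c (hRn0 n) x₁ L₁]
    calc ENNReal.ofReal e₀ = ENNReal.ofReal (Rn n)⁻¹ * ENNReal.ofReal (e₀ * Rn n) := by
          rw [← ENNReal.ofReal_mul (inv_nonneg.2 (hRn0 n).le), mul_comm e₀, ← mul_assoc, inv_mul_cancel₀ (hRn0 n).ne',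
            one_mul]
      _ ≤ ENNReal.ofReal (Rn n)⁻¹ * ∫⁻ y in ball (Rn n • x₁) (Rn n * L₁), ‖v y - c‖ₑ ^ 2 := mul_le_mul' le_rfl (hlow n)
  exact axialJet_false_of_H1rate_on_window hv hdiv hM h1 h2 hpos μ hμ hc0 hc1 hc2 hcM hL6 hslab hE0 hE hRn1 hRn x₁ L₁
    hAtop hDV2 he₀ hlow'

end ExtremiserLiouville

end Summit.NavierStokesRegularity.NavierStokesRegularity.Theorems

end
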